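/-
COR-CM (cell pub-hodgecm2, stage 2 of the Hodge ladder) — count-neutral KERNEL COMBINATORICS «the index-two cyclic law» (modular ∪ semidihedral
columns), part IV: HODGE VECTORS SUPPORTED ON ARC PAIRS — row and column sums are `n`-periodic, and on the HALF CROSS they are multiples of one pair
(seat prover-pub-hodgecm2-b23-g49-0, binder prover b23, gen 49; claim «INDEX-TWO CYCLIC LAW», HOME/INBOX.md l.22678).  Theorems only, on parts I/II
(`Census/IndexTwoCyclicDatum.lean`, `Census/IndexTwoCyclicArcPairs.lean`), seat b23 gen 38ʼs `CyclicFaces.typeSum_apply_eq_sum`, seat b23 gen 48ʼs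
window lemmas (`Dihedral.window_step`, `Dihedral.periodic_of_window`: `Census/DihedralArcPairsHodge.lean`) seat b09ʼs pairs (`Coinvariant.pair`,
`pairSet`: `Census/CoinvariantFibre.lean`) and `QuaternionColumn.two_n_eq_zero` (`Census/QuaternionColumnBiarc.lean`), all BY NAME; no `decide`, no certificate, no named fact, no `sorry`; `Interfaces.lean` (C1), every E term,
B01, `Transposition/*`, `PortJoin/*`, `D2Bridge/*` untouched.
HONEST FRAMING: `HC_CM` is NOT proved, here or anywhere in the tree; nothing here is a period, a count of record or a headline.
T5: n/a-class (hypothesis binders = the fields of `IndexTwoCyclic.Datum`; checker: self).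
-/
import Summits.HodgeConjecture.CorCM.Census.IndexTwoCyclicArcPairs
import Summits.HodgeConjecture.CorCM.Census.DihedralArcPairsHodge

/-!
# The index-two cyclic law, IV: Hodge vectors on arc pairs and on the half cross

THE SETTING of parts I/II: an index-two cyclic datum `D` for `(G, c)` (`G ≅ ℤ/2n ⋊_r ℤ/2`, `c = uⁿ`, involution `w`), the arc pairs
`A(a, b) = biArc D a b`, `(a, b) ∈ (ℤ/2n)²`.  For an integer vector `y` supported on arc pairs write `α(a) = Σ_b y(A(a,b))` (ROW SUMS) and
`β(b) = Σ_a y(A(a,b))` (COLUMN SUMS).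

* §1 the type sums of `y` are window sums: at a rotation `uⁱ` it is `Σ_{a : i ∈ (a, a+n]} α(a)`, at a coset element `uⁱ·w` it is
  `Σ_{b : i ∈ (b, b+n]} β(b)` (`typeSum_pow_of_support`, `typeSum_pow_mul_w_of_support`).
* §2 **if `y` has constant type sum (a Hodge vector) then `α` and `β` are `n`-periodic** (`rowSum_periodic`, `colSum_periodic`) — gen 48ʼs window
  argument, one coordinate at a time (no double window is needed here, for every twist `r`).
* §3 **THE HALF CROSS** `R = {A(a, 0) ∣ a.val ≤ n} ∪ {A(0, b) ∣ b.val ≤ n}`: a vector supported on `R` with constant type sum is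
  `y(A(n,0)) · ([A(n,0)] + [A(0,n)]) = y(A(n,0)) · pair(A(n,0))` (`eq_smul_pair_of_cross`), hence a multiple of a pair (`mem_span_pairSet_of_cross`):
  periodicity kills the coefficients at `0 < a.val < n` (row `a + n` is empty) and at `0 < b.val < n`, then the two relations `α(0) = α(n)`,
  `β(0) = β(n)` force `y(A(0,0)) = 0` and `y(A(n,0)) = y(A(0,n))`.
Part V descends every vector supported on arc pairs to the half cross modulo the unit squares and the pairs.

## References
* [Pohlmann1968] H. Pohlmann, Algebraic cycles on abelian varieties of complex multiplication type, Ann. of Math. 88 (1968), Thm 1.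
* [Milne1999] J. S. Milne, Lefschetz motives and the Tate conjecture, Compositio Math. 117 (1999), Prop. 2.1, p. 54.
-/

namespace Summit.HodgeConjecture.CorCM.Census.IndexTwoCyclic

open Finset
open Summit.HodgeConjecture.CorCM.Prior.AllgGroup.RfwfAllgGroup
open Summit.HodgeConjecture.CorCM.Census.BlockParity
open Summit.HodgeConjecture.CorCM.Census.Coinvariant
open Summit.HodgeConjecture.CorCM.Census.Dihedral (val_add_n window_step periodic_of_window)
open Summit.HodgeConjecture.CorCM.Census.TwistGeneration (val_n)

noncomputable section

variable {G : Type*} [Group G] [Fintype G] [DecidableEq G] {c : G} {n : ℕ} [NeZero n]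
variable (D : Datum G c n)

/-! ## §1 Type sums of vectors supported on arc pairs -/

/-- The integer indicator of `A(a,b)` at a rotation. [folklore] -/
theorem indG_biArc_pow (a b : ZMod (2 * n)) (i : ℕ) :
    indG (biArc D a b).1 (D.u ^ i) = if ((i : ZMod (2 * n)) - a - 1).val < n then 1 else 0 := by
  unfold indG
  by_cases h : ((i : ZMod (2 * n)) - a - 1).val < n
  · rw [if_pos ((pow_mem_biArc D a b i).mpr h), if_pos h]
  · rw [if_neg (fun h' => h ((pow_mem_biArc D a b i).mp h')), if_neg h]

/-- The integer indicator of `A(a,b)` at a coset element. [folklore] -/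
theorem indG_biArc_pow_mul_w (a b : ZMod (2 * n)) (i : ℕ) :
    indG (biArc D a b).1 (D.u ^ i * D.w) = if ((i : ZMod (2 * n)) - b - 1).val < n then 1 else 0 := by
  unfold indG
  by_cases h : ((i : ZMod (2 * n)) - b - 1).val < n
  · rw [if_pos ((pow_mul_w_mem_biArc D a b i).mpr h), if_pos h]
  · rw [if_neg (fun h' => h ((pow_mul_w_mem_biArc D a b i).mp h')), if_neg h]

/-- A sum over the support of a vector supported on arc pairs is a double sum over the parameters. [folklore] -/
theorem sum_support_eq_sum_biArc (y : CMF G c →₀ ℤ) (hsupp : ∀ Ψ ∈ y.support, ∃ a b : ZMod (2 * n), Ψ = biArc D a b) (f : CMF G c → ℤ) :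
    ∑ Φ ∈ y.support, y Φ * f Φ = ∑ a : ZMod (2 * n), ∑ b : ZMod (2 * n), y (biArc D a b) * f (biArc D a b) := by
  classical
  set R : Finset (CMF G c) := (univ ×ˢ univ).image fun ab : ZMod (2 * n) × ZMod (2 * n) => biArc D ab.1 ab.2 with hR
  have hsub : y.support ⊆ R := by
    intro Ψ hΨ
    obtain ⟨a, b, rfl⟩ := hsupp Ψ hΨ
    exact mem_image.mpr ⟨(a, b), mem_product.mpr ⟨mem_univ _, mem_univ _⟩, rfl⟩
  have hinj : ∀ ab ∈ (univ : Finset (ZMod (2 * n))) ×ˢ (univ : Finset (ZMod (2 * n))), ∀ ab' ∈ (univ : Finset (ZMod (2 * n))) ×ˢ univ,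
      biArc D ab.1 ab.2 = biArc D ab'.1 ab'.2 → ab = ab' := fun ab _ ab' _ h =>
    Prod.ext (biArc_injective D h).1 (biArc_injective D h).2
  rw [Finset.sum_subset hsub (fun Ψ _ hΨ => by rw [Finsupp.notMem_support_iff.mp hΨ, zero_mul]), hR, Finset.sum_image hinj,
    Finset.sum_product]

/-- **Type sum at a rotation `uⁱ`** of a vector supported on arc pairs: the window sum `Σ_{a : i ∈ (a, a+n]} α(a)` of the ROW SUMS
`α(a) = Σ_b y(A(a,b))`. [folklore] -/
theorem typeSum_pow_of_support (y : CMF G c →₀ ℤ) (hsupp : ∀ Ψ ∈ y.support, ∃ a b : ZMod (2 * n), Ψ = biArc D a b) (i : ℕ) :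
    typeSum G c y (D.u ^ i) = ∑ a : ZMod (2 * n), if ((i : ZMod (2 * n)) - a - 1).val < n then ∑ b : ZMod (2 * n), y (biArc D a b) else 0 := by
  rw [CyclicFaces.typeSum_apply_eq_sum, sum_support_eq_sum_biArc D y hsupp]
  refine Finset.sum_congr rfl fun a _ => ?_
  by_cases h : ((i : ZMod (2 * n)) - a - 1).val < n
  · rw [if_pos h]
    refine Finset.sum_congr rfl fun b _ => ?_
    rw [indG_biArc_pow, if_pos h, mul_one]
  · rw [if_neg h]
    refine Finset.sum_eq_zero fun b _ => ?_
    rw [indG_biArc_pow, if_neg h, mul_zero]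

/-- **Type sum at a coset element `uⁱ·w`**: the window sum `Σ_{b : i ∈ (b, b+n]} β(b)` of the COLUMN SUMS `β(b) = Σ_a y(A(a,b))`. [folklore] -/
theorem typeSum_pow_mul_w_of_support (y : CMF G c →₀ ℤ) (hsupp : ∀ Ψ ∈ y.support, ∃ a b : ZMod (2 * n), Ψ = biArc D a b) (i : ℕ) :
    typeSum G c y (D.u ^ i * D.w) =
      ∑ b : ZMod (2 * n), if ((i : ZMod (2 * n)) - b - 1).val < n then ∑ a : ZMod (2 * n), y (biArc D a b) else 0 := by
  rw [CyclicFaces.typeSum_apply_eq_sum, sum_support_eq_sum_biArc D y hsupp, Finset.sum_comm]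
  refine Finset.sum_congr rfl fun b _ => ?_
  by_cases h : ((i : ZMod (2 * n)) - b - 1).val < n
  · rw [if_pos h]
    refine Finset.sum_congr rfl fun a _ => ?_
    rw [indG_biArc_pow_mul_w, if_pos h, mul_one]
  · rw [if_neg h]
    refine Finset.sum_eq_zero fun a _ => ?_
    rw [indG_biArc_pow_mul_w, if_neg h, mul_zero]

/-! ## §2 Hodge vectors on arc pairs have periodic row and column sums -/

/-- **The row sums of a Hodge vector supported on arc pairs are `n`-periodic**: `α(a + n) = α(a)`. [folklore] -/
theorem rowSum_periodic (y : CMF G c →₀ ℤ) (hsupp : ∀ Ψ ∈ y.support, ∃ a b : ZMod (2 * n), Ψ = biArc D a b)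
    (hk : ∃ k : ℤ, ∀ x : G, typeSum G c y x = k) (a : ZMod (2 * n)) :
    ∑ b : ZMod (2 * n), y (biArc D (a + n) b) = ∑ b : ZMod (2 * n), y (biArc D a b) := by
  obtain ⟨k, hk⟩ := hk
  set α : ZMod (2 * n) → ℤ := fun a => ∑ b : ZMod (2 * n), y (biArc D a b) with hα
  have hW : ∀ z : ZMod (2 * n), (∑ a, if (z - a - 1).val < n then α a else 0) = k := fun z => by
    have h := typeSum_pow_of_support D y hsupp z.val
    rw [ZMod.natCast_zmod_val, hk] at h
    exact h.symm
  have hstep : ∀ z : ZMod (2 * n), (∑ a, if (z - a).val < n then α a else 0) = ∑ a, if (z - a - 1).val < n then α a else 0 := by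
    intro z
    have h2 := hW (z + 1)
    have e : ∀ a : ZMod (2 * n), z + 1 - a - 1 = z - a := fun a => by ring
    simp only [e] at h2
    rw [h2, hW z]
  exact periodic_of_window α hstep a

/-- **The column sums of a Hodge vector supported on arc pairs are `n`-periodic**: `β(b + n) = β(b)`. [folklore] -/
theorem colSum_periodic (y : CMF G c →₀ ℤ) (hsupp : ∀ Ψ ∈ y.support, ∃ a b : ZMod (2 * n), Ψ = biArc D a b)
    (hk : ∃ k : ℤ, ∀ x : G, typeSum G c y x = k) (b : ZMod (2 * n)) :
    ∑ a : ZMod (2 * n), y (biArc D a (b + n)) = ∑ a : ZMod (2 * n), y (biArc D a b) := by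
  obtain ⟨k, hk⟩ := hk
  set β : ZMod (2 * n) → ℤ := fun b => ∑ a : ZMod (2 * n), y (biArc D a b) with hβ
  have hW : ∀ z : ZMod (2 * n), (∑ b, if (z - b - 1).val < n then β b else 0) = k := fun z => by
    have h := typeSum_pow_mul_w_of_support D y hsupp z.val
    rw [ZMod.natCast_zmod_val, hk] at h
    exact h.symm
  have hstep : ∀ z : ZMod (2 * n), (∑ b, if (z - b).val < n then β b else 0) = ∑ b, if (z - b - 1).val < n then β b else 0 := by
    intro z
    have h2 := hW (z + 1)
    have e : ∀ b : ZMod (2 * n), z + 1 - b - 1 = z - b := fun b => by ring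
    simp only [e] at h2
    rw [h2, hW z]
  exact periodic_of_window β hstep b

/-! ## §3 Hodge vectors on the half cross are multiples of one pair -/

/-- The conjugate of `A(n, 0)` is `A(0, n)`, so `pair(A(n,0)) = [A(n,0)] + [A(0,n)]`. [folklore] -/
theorem pair_biArc_n_zero (hc2 : c * c = 1) :
    pair c (biArc D (n : ZMod (2 * n)) 0) = Finsupp.single (biArc D (n : ZMod (2 * n)) 0) 1 + Finsupp.single (biArc D 0 (n : ZMod (2 * n))) 1 := by
  have _ := hc2
  rw [pair, rt_c_biArc, QuaternionColumn.two_n_eq_zero, zero_add]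

/-- **THEOREM (the half cross).**  A vector with constant type sum supported on the half cross `{A(a,0) ∣ a.val ≤ n} ∪ {A(0,b) ∣ b.val ≤ n}` is
`y(A(n,0)) · pair(A(n,0))`. [folklore] -/
theorem eq_smul_pair_of_cross (hc2 : c * c = 1) (y : CMF G c →₀ ℤ)
    (hsupp : ∀ Ψ ∈ y.support, ∃ a : ZMod (2 * n), a.val ≤ n ∧ (Ψ = biArc D a 0 ∨ Ψ = biArc D 0 a))
    (hk : ∃ k : ℤ, ∀ x : G, typeSum G c y x = k) :
    y = y (biArc D (n : ZMod (2 * n)) 0) • pair c (biArc D (n : ZMod (2 * n)) 0) := by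
  classical
  have hn : 1 ≤ n := Nat.one_le_iff_ne_zero.mpr (NeZero.ne n)
  set N : ZMod (2 * n) := (n : ZMod (2 * n)) with hN
  have hNval : N.val = n := val_n
  have hN0 : N ≠ 0 := fun h => by
    have h2 := congrArg ZMod.val h
    rw [hNval, ZMod.val_zero] at h2
    exact NeZero.ne n h2
  have hsupp' : ∀ Ψ ∈ y.support, ∃ a b : ZMod (2 * n), Ψ = biArc D a b := by
    intro Ψ hΨ
    obtain ⟨a, -, h | h⟩ := hsupp Ψ hΨ
    · exact ⟨a, 0, h⟩
    · exact ⟨0, a, h⟩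
  -- (1) off the axes the vector vanishes
  have hoff : ∀ a b : ZMod (2 * n), a ≠ 0 → b ≠ 0 → y (biArc D a b) = 0 := by
    intro a b ha hb
    by_contra h
    obtain ⟨a', -, h' | h'⟩ := hsupp _ (Finsupp.mem_support_iff.mpr h)
    · exact hb (biArc_injective D h').2
    · exact ha (biArc_injective D h').1
  -- (2) rows: for `a ≠ 0` the row sum is the axis coefficient
  have hrow : ∀ a : ZMod (2 * n), a ≠ 0 → ∑ b : ZMod (2 * n), y (biArc D a b) = y (biArc D a 0) := by
    intro a ha
    exact Finset.sum_eq_single 0 (fun b _ hb => hoff a b ha hb) (fun h => absurd (mem_univ _) h)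
  have hcol : ∀ b : ZMod (2 * n), b ≠ 0 → ∑ a : ZMod (2 * n), y (biArc D a b) = y (biArc D 0 b) := by
    intro b hb
    exact Finset.sum_eq_single 0 (fun a _ ha => hoff a b ha hb) (fun h => absurd (mem_univ _) h)
  -- (3) beyond the half axes the vector vanishes
  have hfarrow : ∀ a : ZMod (2 * n), n < a.val → y (biArc D a 0) = 0 := by
    intro a ha
    by_contra h
    obtain ⟨a', ha', h' | h'⟩ := hsupp _ (Finsupp.mem_support_iff.mpr h)
    · have e := (biArc_injective D h').1
      rw [e] at ha; omega
    · have e := (biArc_injective D h').1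
      have ha0 : a.val = 0 := by rw [e, ZMod.val_zero]
      omega
  have hfarcol : ∀ b : ZMod (2 * n), n < b.val → y (biArc D 0 b) = 0 := by
    intro b hb
    by_contra h
    obtain ⟨a', ha', h' | h'⟩ := hsupp _ (Finsupp.mem_support_iff.mpr h)
    · have e := (biArc_injective D h').2
      have hb0 : b.val = 0 := by rw [e, ZMod.val_zero]
      omega
    · have e := (biArc_injective D h').2
      rw [e] at hb; omega
  -- (4) periodicity kills the open half axes
  have hval_add : ∀ a : ZMod (2 * n), a.val < n → (a + N).val = a.val + n := fun a ha => by
    rw [hN, val_add_n hn, if_pos ha]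
  have hmidrow : ∀ a : ZMod (2 * n), a ≠ 0 → a.val < n → y (biArc D a 0) = 0 := by
    intro a ha0 ha
    have hper := rowSum_periodic D y hsupp' hk a
    have haN0 : a + N ≠ 0 := fun h => by
      have h2 := congrArg ZMod.val h
      rw [hval_add a ha, ZMod.val_zero] at h2; omega
    rw [hrow a ha0, hrow (a + N) haN0, hfarrow (a + N) (by rw [hval_add a ha]; have := ZMod.val_pos.mpr ha0; omega)] at hper
    exact hper.symm
  have hmidcol : ∀ b : ZMod (2 * n), b ≠ 0 → b.val < n → y (biArc D 0 b) = 0 := by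
    intro b hb0 hb
    have hper := colSum_periodic D y hsupp' hk b
    have hbN0 : b + N ≠ 0 := fun h => by
      have h2 := congrArg ZMod.val h
      rw [hval_add b hb, ZMod.val_zero] at h2; omega
    rw [hcol b hb0, hcol (b + N) hbN0, hfarcol (b + N) (by rw [hval_add b hb]; have := ZMod.val_pos.mpr hb0; omega)] at hper
    exact hper.symm
  -- (5) so the support is inside `{A(0,0), A(n,0), A(0,n)}`
  have heqN : ∀ a : ZMod (2 * n), a.val = n → a = N := fun a ha => ZMod.val_injective _ (by rw [ha, hNval])
  have hthree : ∀ Ψ : CMF G c, y Ψ ≠ 0 → Ψ = biArc D 0 0 ∨ Ψ = biArc D N 0 ∨ Ψ = biArc D 0 N := by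
    intro Ψ hΨ
    obtain ⟨a, ha, rfl | rfl⟩ := hsupp Ψ (Finsupp.mem_support_iff.mpr hΨ)
    · by_cases ha0 : a = 0
      · left; rw [ha0]
      · rcases Nat.lt_or_ge a.val n with hlt | hge
        · exact absurd (hmidrow a ha0 hlt) hΨ
        · right; left; rw [heqN a (le_antisymm ha hge)]
    · by_cases ha0 : a = 0
      · left; rw [ha0]
      · rcases Nat.lt_or_ge a.val n with hlt | hge
        · exact absurd (hmidcol a ha0 hlt) hΨ
        · right; right; rw [heqN a (le_antisymm ha hge)]
  -- (6) the two relations at `0` and `n`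
  have hA0N : biArc D 0 0 ≠ biArc D N 0 := fun h => hN0 (biArc_injective D h).1.symm
  have hrow0 : ∑ b : ZMod (2 * n), y (biArc D 0 b) = y (biArc D 0 0) + y (biArc D 0 N) := by
    refine Finset.sum_eq_add 0 N hN0.symm (fun b _ hb => ?_) (fun h => absurd (mem_univ _) h) (fun h => absurd (mem_univ _) h)
    by_contra hy
    rcases hthree _ hy with h | h | h
    · exact hb.1 (biArc_injective D h).2
    · exact hN0 (biArc_injective D h).1.symm
    · exact hb.2 (biArc_injective D h).2
  have hcol0 : ∑ a : ZMod (2 * n), y (biArc D a 0) = y (biArc D 0 0) + y (biArc D N 0) := by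
    refine Finset.sum_eq_add 0 N hN0.symm (fun a _ ha => ?_) (fun h => absurd (mem_univ _) h) (fun h => absurd (mem_univ _) h)
    by_contra hy
    rcases hthree _ hy with h | h | h
    · exact ha.1 (biArc_injective D h).1
    · exact ha.2 (biArc_injective D h).1
    · exact hN0 (biArc_injective D h).2.symm
  have hrel1 : y (biArc D N 0) = y (biArc D 0 0) + y (biArc D 0 N) := by
    have hper := rowSum_periodic D y hsupp' hk 0
    rw [zero_add, hrow N hN0, hrow0] at hper
    exact hper
  have hrel2 : y (biArc D 0 N) = y (biArc D 0 0) + y (biArc D N 0) := by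
    have hper := colSum_periodic D y hsupp' hk 0
    rw [zero_add, hcol N hN0, hcol0] at hper
    exact hper
  have h00 : y (biArc D 0 0) = 0 := by linarith
  have hNN : y (biArc D 0 N) = y (biArc D N 0) := by linarith
  -- (7) compare coefficients
  ext Ψ
  rw [pair_biArc_n_zero D hc2, Finsupp.smul_apply, Finsupp.add_apply, Finsupp.single_apply, Finsupp.single_apply, smul_eq_mul]
  by_cases h1 : biArc D N 0 = Ψ
  · rw [if_pos h1, if_neg (fun h2 => hA0N.symm (by
      have e := biArc_injective D (h1.trans h2.symm)
      exact absurd e.1 hN0)), add_zero, mul_one, h1]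
  · rw [if_neg h1]
    by_cases h2 : biArc D 0 N = Ψ
    · rw [if_pos h2, zero_add, mul_one, ← h2, hNN]
    · rw [if_neg h2, add_zero, mul_zero]
      by_contra hy
      rcases hthree Ψ hy with h | h | h
      · exact hy (by rw [h, h00])
      · exact h1 h.symm
      · exact h2 h.symm

/-- **Hodge vectors on the half cross are pairs**: a vector with constant type sum supported on `{A(a,0) ∣ a.val ≤ n} ∪ {A(0,b) ∣ b.val ≤ n}`
lies in `ℤ⟨pairs⟩`. [folklore] -/
theorem mem_span_pairSet_of_cross (hc2 : c * c = 1) (y : CMF G c →₀ ℤ)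
    (hsupp : ∀ Ψ ∈ y.support, ∃ a : ZMod (2 * n), a.val ≤ n ∧ (Ψ = biArc D a 0 ∨ Ψ = biArc D 0 a))
    (hk : ∃ k : ℤ, ∀ x : G, typeSum G c y x = k) : y ∈ Submodule.span ℤ (pairSet c) := by
  rw [eq_smul_pair_of_cross D hc2 y hsupp hk]
  exact Submodule.smul_mem _ _ (Submodule.subset_span (pair_mem_pairSet c _))

end

end Summit.HodgeConjecture.CorCM.Census.IndexTwoCyclic
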